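import Literature.AlgebraicGeometry.Motives.FaltingsECEndCoreOrdinaryProofs
import Literature.AlgebraicGeometry.Motives.FaltingsECEndCoreBaseChangeProofs
import HarnessLib

/-!
# Faltings 1983, Satz 4 for an elliptic curve: the core fact at a **potentially** ordinary place
# above `ℓ` (Serre 1968, IV.2.2 with A.2.2, after a finite extension of the base field)

Theorem-only sequel of `FaltingsECEndCoreOrdinaryProofs` (the core fact of Satz 4 / Serre IV.2.2
for a curve with a place `v ∣ ℓ` of good ordinary reduction, `ℓ` odd) and
`FaltingsECEndCoreBaseChangeProofs` (the scalar-commutant core statement descends along finite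
extensions `L/K`): the named fact `exists_eq_smul_one_of_equivariant_of_not_hasRationalCM W ℓ`
(`FaltingsECEndCore`), Faltings' Satz 4 (`mem_span_range_tateEndRingHom_iff`), the subspace
statement for `E × E` (`stable_subspace_prod_eq_range`) and Korollar 1 for `(E, E)`
(`mem_span_range_tateModule_map_of_equivariant W W ℓ`) for a curve `E/K` which acquires an
ordinary good place above `ℓ` over some finite extension `L/K` (`ℓ` odd), and the sharpened
frontier `exists_eq_smul_one_of_equivariant_of_not_hasRationalCM_of_residual''`: over a number
field the named fact reduces to `¬ HasCM`, `K` totally imaginary, `j` integral at all `v ∤ ℓ`, and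
(`ℓ = 2` or) `E` potentially supersingular or potentially multiplicative at every place above `ℓ`.

## References

* [SerreAbelianLadic1968] J.-P. Serre, *Abelian ℓ-adic representations and elliptic curves*
  (1968), Ch. IV §2.2 and A.2.2.
* [Faltings1983Endlichkeit] G. Faltings, Invent. Math. 73 (1983), §5 Satz 4 and Korollar 1.
-/

noncomputable section

open scoped TensorProduct

universe u

namespace Literature.AlgebraicGeometry.Motives

open WeierstrassCurve Module Literature.NumberTheory.EllipticCurves
  Literature.NumberTheory.GaloisRepresentations Field IsDedekindDomain
open scoped NumberField

/-! ## Potentially: an ordinary good place above `ℓ` over a finite extension -/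

section Potential

variable {K : Type u} [Field K] (W : WeierstrassCurve K) (ℓ : ℕ) [hℓ : Fact ℓ.Prime]

/-- **The named core fact for a curve acquiring an ordinary good place above `ℓ` over a finite
extension** (`ℓ` odd): if for some finite extension `L/K` of number fields and some place `w ∣ ℓ`
of `L` the base change `E_L` has a good model over `𝓞_w` with unit Hasse invariant, then
`exists_eq_smul_one_of_equivariant_of_not_hasRationalCM W ℓ` holds — the ordinary case
(`exists_eq_smul_one_of_equivariant_of_isUnit_hasseCoeff` for `E_L`) descended along `L/K`
(`exists_eq_smul_one_of_equivariant_of_not_hasRationalCM_of_extension`: Serre 1968, IV.2.2,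
"replacing `K` by a finite extension").  Covers potentially good ordinary reduction above `ℓ`.
[cite: SerreAbelianLadic1968, IV.2.2 and A.2.2] -/
theorem exists_eq_smul_one_of_equivariant_of_not_hasRationalCM_of_isUnit_hasseCoeff_of_extension
    (L : Type u) [Field L] [NumberField L] [Algebra K L] {w : HeightOneSpectrum (𝓞 L)}
    (hℓw : (ℓ : 𝓞 L) ∈ w.asIdeal) (hℓ2 : ℓ ≠ 2)
    {C : VariableChange (w.adicCompletion L)} {M : WeierstrassCurve (w.adicCompletionIntegers L)}
    (hCM : C • (W.baseChange L).baseChange (w.adicCompletion L) =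
      M.map (algebraMap (w.adicCompletionIntegers L) (w.adicCompletion L))) (hΔ : IsUnit M.Δ)
    (hA : IsUnit (M.hasseCoeff ℓ)) :
    exists_eq_smul_one_of_equivariant_of_not_hasRationalCM W ℓ := by
  refine exists_eq_smul_one_of_equivariant_of_not_hasRationalCM_of_extension W ℓ L ?_
  intro _ _ hnl' G' hG'
  exact exists_eq_smul_one_of_equivariant_of_isUnit_hasseCoeff (W.baseChange L) ℓ hℓw hℓ2 hCM hΔ hA
    hnl' G' hG'

/-- **Faltings' Satz 4 for a curve with an ordinary good place above `ℓ` over a finite extension**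
(unconditional; `ℓ` odd): the named fact `mem_span_range_tateEndRingHom_iff W ℓ`.
[cite: Faltings1983Endlichkeit, §5 Satz 4 (case of a potentially ordinary place above ℓ)] -/
theorem mem_span_range_tateEndRingHom_iff_of_isUnit_hasseCoeff_of_extension
    (L : Type u) [Field L] [NumberField L] [Algebra K L] {w : HeightOneSpectrum (𝓞 L)}
    (hℓw : (ℓ : 𝓞 L) ∈ w.asIdeal) (hℓ2 : ℓ ≠ 2)
    {C : VariableChange (w.adicCompletion L)} {M : WeierstrassCurve (w.adicCompletionIntegers L)}
    (hCM : C • (W.baseChange L).baseChange (w.adicCompletion L) =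
      M.map (algebraMap (w.adicCompletionIntegers L) (w.adicCompletion L))) (hΔ : IsUnit M.Δ)
    (hA : IsUnit (M.hasseCoeff ℓ)) : mem_span_range_tateEndRingHom_iff W ℓ :=
  mem_span_range_tateEndRingHom_iff_of_core W ℓ
    (exists_eq_smul_one_of_equivariant_of_not_hasRationalCM_of_isUnit_hasseCoeff_of_extension W ℓ L
      hℓw hℓ2 hCM hΔ hA)

/-- **Faltings' subspace statement for `E × E` for a curve with an ordinary good place above `ℓ`
over a finite extension** (unconditional; `ℓ` odd): the named fact `stable_subspace_prod_eq_range W ℓ`.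
[cite: Faltings1983Endlichkeit, §5, Sätze 3–4 (case of a potentially ordinary place above ℓ)] -/
theorem stable_subspace_prod_eq_range_of_isUnit_hasseCoeff_of_extension
    (L : Type u) [Field L] [NumberField L] [Algebra K L] {w : HeightOneSpectrum (𝓞 L)}
    (hℓw : (ℓ : 𝓞 L) ∈ w.asIdeal) (hℓ2 : ℓ ≠ 2)
    {C : VariableChange (w.adicCompletion L)} {M : WeierstrassCurve (w.adicCompletionIntegers L)}
    (hCM : C • (W.baseChange L).baseChange (w.adicCompletion L) =
      M.map (algebraMap (w.adicCompletionIntegers L) (w.adicCompletion L))) (hΔ : IsUnit M.Δ)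
    (hA : IsUnit (M.hasseCoeff ℓ)) : stable_subspace_prod_eq_range W ℓ :=
  stable_subspace_prod_eq_range_of_core W ℓ
    (exists_eq_smul_one_of_equivariant_of_not_hasRationalCM_of_isUnit_hasseCoeff_of_extension W ℓ L
      hℓw hℓ2 hCM hΔ hA)

/-- **Faltings' Korollar 1 for `(E, E)` for a curve with an ordinary good place above `ℓ` over a
finite extension** (unconditional; `ℓ` odd): the named fact
`mem_span_range_tateModule_map_of_equivariant W W ℓ`.
[cite: Faltings1983Endlichkeit, §5 Satz 4, Korollar 1 (case of a potentially ordinary place above ℓ)] -/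
theorem mem_span_range_tateModule_map_of_equivariant_self_of_isUnit_hasseCoeff_of_extension
    (L : Type u) [Field L] [NumberField L] [Algebra K L] {w : HeightOneSpectrum (𝓞 L)}
    (hℓw : (ℓ : 𝓞 L) ∈ w.asIdeal) (hℓ2 : ℓ ≠ 2)
    {C : VariableChange (w.adicCompletion L)} {M : WeierstrassCurve (w.adicCompletionIntegers L)}
    (hCM : C • (W.baseChange L).baseChange (w.adicCompletion L) =
      M.map (algebraMap (w.adicCompletionIntegers L) (w.adicCompletion L))) (hΔ : IsUnit M.Δ)
    (hA : IsUnit (M.hasseCoeff ℓ)) : mem_span_range_tateModule_map_of_equivariant W W ℓ := by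
  intro _ _ _
  exact mem_span_range_tateModule_map_of_equivariant_self_of_isogenyClass_of_core W ℓ
    (finite_isogenyClass_holds W)
    (exists_eq_smul_one_of_equivariant_of_not_hasRationalCM_of_isUnit_hasseCoeff_of_extension W ℓ L
      hℓw hℓ2 hCM hΔ hA)

/-- **What is left of the core fact after the potentially ordinary places above `ℓ`.**  Over a
number field, `exists_eq_smul_one_of_equivariant_of_not_hasRationalCM W ℓ` reduces to the case:
no complex multiplication over `K̄`, `K` totally imaginary, `j(E)` integral at every `v ∤ ℓ`, and
either `ℓ = 2` or **no finite extension `L/K` has a place `w ∣ ℓ` at which `E_L` has a good model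
over `𝓞_w` with unit Hasse invariant** — i.e. `E` has potentially supersingular good reduction or
potentially multiplicative reduction at every place above `ℓ`.  There Serre's theorem needs the
Hodge–Tate decomposition (1968, III and IV.A.2.3–A.2.4) or Faltings' Finiteness I.
[cite: SerreAbelianLadic1968, IV.2.2] [cite: Faltings1983Endlichkeit, §5 Satz 4] -/
theorem exists_eq_smul_one_of_equivariant_of_not_hasRationalCM_of_residual'' [NumberField K]
    [W.IsElliptic]
    (h : ¬ W.HasCM → IsEmpty (K →+* ℝ) →
      (∀ v : HeightOneSpectrum (𝓞 K), (ℓ : 𝓞 K) ∉ v.asIdeal → v.valuation K W.j ≤ 1) →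
      (ℓ = 2 ∨ ∀ (L : Type u) [Field L] [NumberField L] [Algebra K L]
          (w : HeightOneSpectrum (𝓞 L)) (C : VariableChange (w.adicCompletion L))
          (M : WeierstrassCurve (w.adicCompletionIntegers L)), (ℓ : 𝓞 L) ∈ w.asIdeal →
          C • (W.baseChange L).baseChange (w.adicCompletion L) =
            M.map (algebraMap (w.adicCompletionIntegers L) (w.adicCompletion L)) →
          IsUnit M.Δ → ¬ IsUnit (M.hasseCoeff ℓ)) →
      exists_eq_smul_one_of_equivariant_of_not_hasRationalCM W ℓ) :
    exists_eq_smul_one_of_equivariant_of_not_hasRationalCM W ℓ := by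
  refine exists_eq_smul_one_of_equivariant_of_not_hasRationalCM_of_residual W ℓ
    fun hCM hR hj ↦ ?_
  by_cases hℓ2 : ℓ = 2
  · exact h hCM hR hj (Or.inl hℓ2)
  by_cases hord : ∀ (L : Type u) [Field L] [NumberField L] [Algebra K L]
      (w : HeightOneSpectrum (𝓞 L)) (C : VariableChange (w.adicCompletion L))
      (M : WeierstrassCurve (w.adicCompletionIntegers L)), (ℓ : 𝓞 L) ∈ w.asIdeal →
      C • (W.baseChange L).baseChange (w.adicCompletion L) =
        M.map (algebraMap (w.adicCompletionIntegers L) (w.adicCompletion L)) →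
      IsUnit M.Δ → ¬ IsUnit (M.hasseCoeff ℓ)
  · exact h hCM hR hj (Or.inr hord)
  · push Not at hord
    obtain ⟨L, _, _, _, w, C, M, hℓw, hCM', hΔ, hA⟩ := hord
    exact exists_eq_smul_one_of_equivariant_of_not_hasRationalCM_of_isUnit_hasseCoeff_of_extension
      W ℓ L hℓw hℓ2 hCM' hΔ hA

end Potential

end Literature.AlgebraicGeometry.Motives

end
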